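import Summits.ResolutionOfSingularities.ResolutionOfSingularities.Theorems.HomologicalConductorSurfaceTerminationPrintDebtDoors
import Summits.ResolutionOfSingularities.ResolutionOfSingularities.Theorems.HomologicalConductorSurfaceTerminationGenusNonincreasingCJS
import HarnessLib

/-!
# Kill test `SurfaceTermination` (stmt-ResolutionOfSingularities-16488): the genus-descent door with THREE prints —
# Görtz–Wedhorn 24.44 is idle

Route `ResolutionOfSingularities/HomologicalConductor`.  OURS (hand leafhand-res-homologicalconduct-20 g1, 2026-08-31);
nothing here is a statement of the manuscript under review (Hironaka 2017); AI-written, weaker than expert review.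

`PrintDebtDoors.surfaceTermination_of_prints_of_initialPair` (hand 20 g0, p831285) carries FOUR prints
{`CossartJannsenSaito2020General`, `Lipman1969_4_1`, `Lipman1969_12_1_ii`, `GortzWedhorn2023_24_44_H2`} and the line's
(E)-form residue; Görtz–Wedhorn 24.44 enters only through the genus monotonicity `hasGeometricGenusLE_tower_succ_succ`.
But the tree already has the monotonicity modulo CJS 2020 ALONE —
`GenusDescent.hasGeometricGenusLE_tower_succ_succ_of_cjs` (`…GenusNonincreasingCJS`, hand 3 g1: the middle model
`Bl_ca(Spec T_(m+1))` is projective over `T_(m+1)`, so the gluing step is the fact-free projective form of Görtz–Wedhorn 24.44,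
and the domination step between two regular models is print-free).  Re-running hand 20's composition over it:

* **`surfaceTermination_of_prints3_of_initialPair`** — `CossartJannsenSaito2020General`, `Lipman1969_4_1`,
  `Lipman1969_12_1_ii` (THREE prints, the same three as the capture door
  `surfaceTermination_of_prints_of_nonrationalCapture`) + the unconditional (E)-form residue ⇒ `SurfaceTermination` BY NAME;
* **`primeDivisorSurfaceTermination_of_prints3_of_initialPair`** — the same onto the prime-divisor case
  `Reduction.PrimeDivisorSurfaceTermination` (the (D-s) node of the reduction), for consumers that compose differently;
* **`surfaceTermination_of_prints3_of_noEternalGenus`** — the residue in its WEAKEST used form: what the descent consumes is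
  only «no eternal positive constant geometric genus along a prime divisor» (rev 3's `Sig.stub_constantGenusPrimeDivisor`
  without its fact binder); the (E)-form initial pair is one way to produce it (`exists_regular_of_initialPair`).

So the exact print debt of the genus-descent line of 16488 is {CJS 2020 Thm 1.2, Lipman (4.1), Lipman (12.1)(ii)} + the
residue, and both doors of the kill test (genus descent / non-rational capture) now carry the SAME three prints.
No new definitions; named-fact hypotheses explicit.  No crux, kill test or summit statement is proved here; resolution of
singularities in positive characteristic is NOT proved.

References: J. Lipman, Publ. Math. IHÉS 36 (1969), (4.1), (12.1) [`Lipman1969`]; V. Cossart, U. Jannsen, S. Saito (2020),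
Thm. 1.2 [`CossartJannsenSaito2020`]; U. Görtz, T. Wedhorn, AG II (2023), Cor. 24.44 [`GortzWedhorn2023`].
-/

set_option linter.dupNamespace false

noncomputable section

namespace Summit.ResolutionOfSingularities.ResolutionOfSingularities.Theorems.SurfaceTermination.PrintDebtDoors

open Summit.ResolutionOfSingularities.ResolutionOfSingularities.Theses.HomologicalConductor (SurfaceTermination)
open Summit.ResolutionOfSingularities.ResolutionOfSingularities.Theorems
open Summit.ResolutionOfSingularities.ResolutionOfSingularities.Theorems.NoZeno.Birth
open Summit.ResolutionOfSingularities.ResolutionOfSingularities.Theorems.NoZeno.SandwichCluster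
open Summit.ResolutionOfSingularities.ResolutionOfSingularities.Theorems.SurfaceTermination.GenusDescent
open Summit.ResolutionOfSingularities.ResolutionOfSingularities.Theorems.SurfaceTermination.GenusDescentDoor
open Summit.ResolutionOfSingularities.ResolutionOfSingularities.Theorems.SurfaceTermination.Descent
open Summit.ResolutionOfSingularities.ResolutionOfSingularities.Theorems.SurfaceTermination.Reduction
  (PrimeDivisorSurfaceTermination)
open Literature.AlgebraicGeometry.Resolution Literature.AlgebraicGeometry.Morphisms Polynomial
open CategoryTheory AlgebraicGeometry

/-- **THREE prints + «no eternal positive constant genus along a prime divisor» ⇒ the prime-divisor case (D-s).**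
Prints: CJS 2020 Thm 1.2 (resolutions of the stages; genus finiteness AND monotonicity, the latter by
`hasGeometricGenusLE_tower_succ_succ_of_cjs`), Lipman (4.1) and (12.1)(ii) ((R2) at rational stages,
`Descent.FourFacts.rationalStageTermination4`); Lipman (1.2) is the tree theorem `Lipman1969_1_2_holds`.  Residue
(weakest used form): along a prime divisor the geometric genus of the stages `T_(m'+1)` is not a constant `g + 1 ≥ 1` for
all `m' ≥ m`.  Proof: bound `p_g(T₁) ≤ g`, descend on `g` (`exists_genusZero_stage`), a genus-`0` stage is rational, (R2).
[cite: CossartJannsenSaito2020, Thm. 1.2] [cite: Lipman1969, Theorem (4.1) (p. 204) and Theorem (12.1) (ii) (p. 220)] -/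
theorem primeDivisorSurfaceTermination_of_prints3_of_noEternalGenus
    (hCJS : CossartJannsenSaito2020General.{0}) (h41 : Lipman1969_4_1.{0}) (h12ii : Lipman1969_12_1_ii.{0})
    (hDrop : ∀ p : ℕ, p.Prime → ∀ (k K : Type) [Field k] [CharP k p] [Field K] [Algebra k K]
      (O : ValuationSubring K) (A : Subalgebra k K) (hk : ∀ c : k, algebraMap k K c ∈ O), A.FG →
      IsFractionRing ↥A K → A.toSubring ≤ O.toSubring → ringKrullDim ↥A = 2 →
      O ≠ ⊤ → IsDiscreteValuationRing ↥O → residueTrdeg k O hk + 1 = Algebra.trdeg k K →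
      ∀ g m : ℕ, (∀ m' : ℕ, m ≤ m' →
        HasGeometricGenusLE ↥(tower O A (m' + 1)) (g + 1) ∧ ¬ HasGeometricGenusLE ↥(tower O A (m' + 1)) g) →
        False) :
    PrimeDivisorSurfaceTermination := by
  have h12 : Lipman1969_1_2.{0} := NoZeno.Lipman12B.Lipman1969_1_2_holds
  have hF4 : (CossartJannsenSaito2020General.{0} ∧ Lipman1969_1_2.{0} ∧ Lipman1969_4_1.{0} ∧
      Lipman1969_12_1_ii.{0}) := ⟨hCJS, h12, h41, h12ii⟩
  intro p hp k K _ _ _ _ O A hk hA hfr hAO hdim hOtop hdvr hres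
  show ∃ m : ℕ, IsRegularLocalRing ↥(tower O A m)
  haveI := hfr
  have htr : Algebra.trdeg k K = 2 := trdeg_eq_two_of_ringKrullDim A hA hfr hdim
  obtain ⟨g, hg⟩ := exists_hasGeometricGenusLE_tower_succ hCJS p hp k K O A hk hA hfr hAO htr 0
  obtain ⟨m₁, hm₁⟩ := exists_genusZero_stage (fun n => tower O A (n + 1))
    (fun g m h => hasGeometricGenusLE_tower_succ_succ_of_cjs hCJS O A hk hA hfr hAO htr m g h)
    (fun g m h => hDrop p hp k K O A hk hA hfr hAO hdim hOtop hdvr hres g m h) g 0 hg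
  exact Descent.FourFacts.rationalStageTermination4 hF4 p hp k K O A hk hA hfr hAO hdim m₁
    (hasRationalSingularity_of_genusLE_zero hm₁)

/-- **THREE prints + «no eternal positive constant genus along a prime divisor» ⇒ `SurfaceTermination` BY NAME**
(through the four-print reduction to the prime-divisor case `Reduction.FourFacts.surfaceTermination_of_primeDivisorCase_of_facts4`,
Lipman (1.2) from the tree). [cite: CossartJannsenSaito2020, Thm. 1.2]
[cite: Lipman1969, Theorem (4.1) (p. 204) and Theorem (12.1) (ii) (p. 220)] -/
theorem surfaceTermination_of_prints3_of_noEternalGenus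
    (hCJS : CossartJannsenSaito2020General.{0}) (h41 : Lipman1969_4_1.{0}) (h12ii : Lipman1969_12_1_ii.{0})
    (hDrop : ∀ p : ℕ, p.Prime → ∀ (k K : Type) [Field k] [CharP k p] [Field K] [Algebra k K]
      (O : ValuationSubring K) (A : Subalgebra k K) (hk : ∀ c : k, algebraMap k K c ∈ O), A.FG →
      IsFractionRing ↥A K → A.toSubring ≤ O.toSubring → ringKrullDim ↥A = 2 →
      O ≠ ⊤ → IsDiscreteValuationRing ↥O → residueTrdeg k O hk + 1 = Algebra.trdeg k K →
      ∀ g m : ℕ, (∀ m' : ℕ, m ≤ m' →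
        HasGeometricGenusLE ↥(tower O A (m' + 1)) (g + 1) ∧ ¬ HasGeometricGenusLE ↥(tower O A (m' + 1)) g) →
        False) :
    SurfaceTermination := by
  have h12 : Lipman1969_1_2.{0} := NoZeno.Lipman12B.Lipman1969_1_2_holds
  exact Reduction.FourFacts.surfaceTermination_of_primeDivisorCase_of_facts4 ⟨hCJS, h12, h41, h12ii⟩
    (primeDivisorSurfaceTermination_of_prints3_of_noEternalGenus hCJS h41 h12ii hDrop)

/-- **THREE prints + the unconditional (E)-form residue ⇒ the prime-divisor case (D-s).**  Residue: along a prime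
divisor, an eternal positive constant geometric genus yields an INITIAL PAIR at some stage `m'` (`g₀, g₁ ∈ ca (tower O A m')`,
`g₀ ≠ 0` of minimal `O`-value on `ca`, `g₁ * g₀⁻¹` residually transcendental over `k`) — the line's stub 5 without its fact
binder.  An initial pair gives a regular stage (`exists_regular_of_initialPair`, LEMMA E), regular stages are terminal and
rational, hence of genus `0 ≤ g` — so there is no eternal positive constant genus, and the previous door applies.
[cite: CossartJannsenSaito2020, Thm. 1.2] [cite: Lipman1969, Theorem (4.1) (p. 204) and Theorem (12.1) (ii) (p. 220)] -/
theorem primeDivisorSurfaceTermination_of_prints3_of_initialPair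
    (hCJS : CossartJannsenSaito2020General.{0}) (h41 : Lipman1969_4_1.{0}) (h12ii : Lipman1969_12_1_ii.{0})
    (hPair : ∀ p : ℕ, p.Prime → ∀ (k K : Type) [Field k] [CharP k p] [Field K] [Algebra k K]
      (O : ValuationSubring K) (A : Subalgebra k K) (hk : ∀ c : k, algebraMap k K c ∈ O), A.FG →
      IsFractionRing ↥A K → A.toSubring ≤ O.toSubring → ringKrullDim ↥A = 2 →
      O ≠ ⊤ → IsDiscreteValuationRing ↥O → residueTrdeg k O hk + 1 = Algebra.trdeg k K →
      ∀ g m : ℕ, (∀ m' : ℕ, m ≤ m' →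
        HasGeometricGenusLE ↥(tower O A (m' + 1)) (g + 1) ∧ ¬ HasGeometricGenusLE ↥(tower O A (m' + 1)) g) →
        ∃ (m' : ℕ) (g₀ g₁ : K), g₀ ∈ ca (tower O A m') ∧ g₁ ∈ ca (tower O A m') ∧ g₀ ≠ 0 ∧
          (∀ c ∈ ca (tower O A m'), c * g₀⁻¹ ∈ O) ∧
          ∀ f : k[X], f ≠ 0 → ¬ O.valuation (aeval (g₁ * g₀⁻¹) f) < 1) :
    PrimeDivisorSurfaceTermination := by
  refine primeDivisorSurfaceTermination_of_prints3_of_noEternalGenus hCJS h41 h12ii ?_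
  intro p hp k K _ _ _ _ O A hk hA hfr hAO hdim hOtop hdvr hres g m h
  haveI := hfr
  obtain ⟨m', g₀, g₁, hg₀, hg₁, hg₀0, hmin, hval⟩ := hPair p hp k K O A hk hA hfr hAO hdim hOtop hdvr hres g m h
  obtain ⟨m'', hreg⟩ := exists_regular_of_initialPair p hp k K O A hk hA hfr hAO hdim m' hg₀ hg₁ hg₀0 hmin hval
  have hreg' : IsRegularLocalRing ↥(tower O A (m'' + m + 1)) :=
    isRegularLocalRing_tower_of_le O A hk hfr hAO (by omega) hreg
  have hrat : HasRationalSingularity ↥(tower O A (m'' + m + 1)) := by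
    haveI := hreg'
    exact hasRationalSingularity_of_isRegularLocalRing _
  exact (h (m'' + m) (Nat.le_add_left m m'')).2
    (hasGeometricGenusLE_mono (Nat.zero_le g) ((hasGeometricGenusLE_zero_iff _).mpr hrat))

/-- **THREE prints + the unconditional (E)-form residue ⇒ `SurfaceTermination` BY NAME** — hand 20's door
`surfaceTermination_of_prints_of_initialPair` with the Görtz–Wedhorn binder REMOVED (it was idle: genus monotonicity is
`hasGeometricGenusLE_tower_succ_succ_of_cjs`).  Prints: `CossartJannsenSaito2020General`, `Lipman1969_4_1`,
`Lipman1969_12_1_ii`; Lipman (1.2) from the tree. [cite: CossartJannsenSaito2020, Thm. 1.2]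
[cite: Lipman1969, Theorem (4.1) (p. 204) and Theorem (12.1) (ii) (p. 220)] -/
theorem surfaceTermination_of_prints3_of_initialPair
    (hCJS : CossartJannsenSaito2020General.{0}) (h41 : Lipman1969_4_1.{0}) (h12ii : Lipman1969_12_1_ii.{0})
    (hPair : ∀ p : ℕ, p.Prime → ∀ (k K : Type) [Field k] [CharP k p] [Field K] [Algebra k K]
      (O : ValuationSubring K) (A : Subalgebra k K) (hk : ∀ c : k, algebraMap k K c ∈ O), A.FG →
      IsFractionRing ↥A K → A.toSubring ≤ O.toSubring → ringKrullDim ↥A = 2 →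
      O ≠ ⊤ → IsDiscreteValuationRing ↥O → residueTrdeg k O hk + 1 = Algebra.trdeg k K →
      ∀ g m : ℕ, (∀ m' : ℕ, m ≤ m' →
        HasGeometricGenusLE ↥(tower O A (m' + 1)) (g + 1) ∧ ¬ HasGeometricGenusLE ↥(tower O A (m' + 1)) g) →
        ∃ (m' : ℕ) (g₀ g₁ : K), g₀ ∈ ca (tower O A m') ∧ g₁ ∈ ca (tower O A m') ∧ g₀ ≠ 0 ∧
          (∀ c ∈ ca (tower O A m'), c * g₀⁻¹ ∈ O) ∧
          ∀ f : k[X], f ≠ 0 → ¬ O.valuation (aeval (g₁ * g₀⁻¹) f) < 1) :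
    SurfaceTermination := by
  have h12 : Lipman1969_1_2.{0} := NoZeno.Lipman12B.Lipman1969_1_2_holds
  exact Reduction.FourFacts.surfaceTermination_of_primeDivisorCase_of_facts4 ⟨hCJS, h12, h41, h12ii⟩
    (primeDivisorSurfaceTermination_of_prints3_of_initialPair hCJS h41 h12ii hPair)

end Summit.ResolutionOfSingularities.ResolutionOfSingularities.Theorems.SurfaceTermination.PrintDebtDoors

end
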